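import Summits.BirchSwinnertonDyer.BirchSwinnertonDyer.Theorems.ClassRecordThreeEulerHalvesAtThreeHybridInertShape
import Summits.BirchSwinnertonDyer.BirchSwinnertonDyer.Theorems.ClassRecordThreeEulerHalvesAtThreePoitouTateOfCanonical
import Summits.BirchSwinnertonDyer.BirchSwinnertonDyer.Theorems.ClassRecordThreeEulerHalvesAtThreeTwistLowerOfX11a
import Summits.BirchSwinnertonDyer.BirchSwinnertonDyer.Theorems.ClassRecordThreeKolyvaginShaOrderDivisibleEnd
import Summits.BirchSwinnertonDyer.BirchSwinnertonDyer.Theorems.ClassRecordThreeEulerHalvesAtThreeInertDisplayOfPrimitives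
import Summits.BirchSwinnertonDyer.BirchSwinnertonDyer.Theorems.ClassRecordThreeEulerHalvesAtThreeNotRamInertServableCutNormalForm
import Summits.BirchSwinnertonDyer.BirchSwinnertonDyer.Theorems.ClassRecordThreeEulerHalvesAtThreeShimuraInertSavingDisplayOfE0Prime
import Summits.BirchSwinnertonDyer.BirchSwinnertonDyer.Theorems.ClassRecordThreeEulerHalvesAtThreeShimuraAuxNormE0Prime
import Summits.BirchSwinnertonDyer.BirchSwinnertonDyer.Theorems.ClassRecordThreeEulerHalvesAtThreeAuxInertLevelOfChebotarev
import Summits.BirchSwinnertonDyer.BirchSwinnertonDyer.Theorems.ClassRecordThreeEulerHalvesAtThreeAuxInertLevelAtThree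
import Summits.BirchSwinnertonDyer.BirchSwinnertonDyer.Theorems.ClassRecordThreeEulerHalvesAtThreeCarrierLocalE0AtThree
import Summits.BirchSwinnertonDyer.BirchSwinnertonDyer.Theorems.ClassRecordThreeCornerAtThreeMilneTamagawaHolds
import Summits.BirchSwinnertonDyer.BirchSwinnertonDyer.Theorems.SchneiderFreeAdditiveX3PoitouTateReciprocitySumHolds
import Summits.BirchSwinnertonDyer.BirchSwinnertonDyer.Theorems.SemiOrdinaryEisensteinDescentShaTwoCochainShell
import Summits.BirchSwinnertonDyer.BirchSwinnertonDyer.Theorems.SemiOrdinaryEisensteinDescentShaTwoCochainBridgeAssemblyCriterion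
import Summits.BirchSwinnertonDyer.BirchSwinnertonDyer.Theorems.SemiOrdinaryEisensteinDescentShaTwoCochainClassReadout
import Literature.NumberTheory.EllipticCurves.HeegnerPointsIdentityComponentProofs
import Summits.BirchSwinnertonDyer.BirchSwinnertonDyer.Theorems.ClassRecordThreeEulerHalvesAtThreeCoStepLDefs
import Summits.BirchSwinnertonDyer.BirchSwinnertonDyer.Theorems.ClassRecordThreeEulerHalvesAtThreeOfItemsR21
import Summits.BirchSwinnertonDyer.BirchSwinnertonDyer.Theorems.ClassRecordThreeEulerHalvesAtThreeExtraRoadCutComposition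
import HarnessLib

/-!
# Crux 19109 `EulerHalvesAtThree` after RULING 77 (c): CLOSERS around the OUTPUT-form residue (tam3-p1 g19)
# Route `ClassRecordThree` ∕ `KolyvaginRoadThree` (rung K2@3), cell `bsd-stepL`, seat `bsd-stepL-tam3-p1` g19 (line owner of 19109; `--supports 19109`)

HONEST FRAMING: theorems only (no definition, no named fact, no `sorry`); every theorem is CONDITIONAL on route items taken BY NAME and ∕ or
on OPEN statements displayed RAW as hypotheses (nothing asserted); item 19109 does NOT close by this file; nothing is asserted about any
curve; BSD is proved for no curve; no census word, tier or label moves (T7).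

WHY. RULING 77 (plan g43, 2026-08-28T20:15Z) puts the roads attacking 19109's residue as LINES on a residue crux, and names item 23334
`EulerHalvesAtThreeCoStepLResidual` (IMC form: `∀ W, MultiCarrierAt W → ResidualNormalFormAt W → CoStepLAt W`, the «⊇» inequality
`IMCUpperWaldspurgerOnTreeAt` on every surj Heegner frame). bsd-idea-10's CARTAN road does not conclude that: its output is the Selmer BOUND
`Typed.MissingUpperBoundAt W 3` (`CartanKernel.cartanRoadAtThree_of_inputs : Three.CartanRoadAtThree`, p662140), and nothing in the tree or in
print converts a bound back into the IMC inequality on frames. The common target of both roads is the OUTPUT-form residue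
    `(Z)  ∀ W, ClassX11b W 3 → Surj W 3 → MultiCarrierAt W → ResidualNormalFormAt W → Typed.MissingUpperBoundAt W 3`
(named `Theorems.EulerHalvesAtThreeResidualUpperBound` in the companion Defs proposal `…ResidualUpperBoundDefs.lean`; this file states (Z)
UNFOLDED so that it lands independently — every theorem below applies to the named constant by `δ`).

WHAT (namespace `…Theorems.EulerHalvesResidualUB`).
* §1 `missingUpperBoundAt_three_of_classX11b_of_surj_of_coStepLAt` — the co-chain conversion AT ONE CURVE without a (ram) case distinction:
  print inputs ∧ Poitou–Tate (both dualities) ∧ TL₃ ∧ `CoStepLAt W` ∧ X11b ∧ surj ⟹ `MissingUpperBoundAt W 3`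
  (`Koly.missingUpperBoundAt_three_of_classX11b_of_ram_of_coStepLAt` if (ram), `…_of_surj_of_coStepLAt_of_twistLower` otherwise).
* §2 line `costepl` (ZERO stubs): `residualUpperBound_of_items_of_coStepLResidual` — (Z) from the route items 19112 `PublishedInputsThree`,
  23176 `PoitouTateShaTateDualFact`, 23178 `X11aLowerHalfAtThree` (TL₃ via `Koly.twistLowerAtThree_of_thmC_of_x11aLowerHalfAtThree`) and 23334, all BY
  NAME (+ the kernel theorem `…selmerComplement_canonical_holds` for the Selmer-structure duality); `kolyvaginRoadThree_…` twin over KR3's copies.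
* §3 line `cartan`: `residualUpperBound_of_items_of_cartanRoad_of_coStepLOffCartan` — (Z) from the same items, the Cartan road
  `Three.CartanRoadAtThree` (DERIVED from its inputs by p662140) and the SMALLER IMC-form residue `Three.CoStepLResidualOffCartanAtThree`; twin.
* §4 r25 of line `inert`: `eulerHalvesAtThree_of_items_of_residualUpperBound` — crux 19109 BY NAME from its seven other route items BY NAME and (Z):
  the road-agnostic composition p658732 at `Φ := residual class` (`hRoad` := (Z), `hcoRes` VACUOUS — its hypotheses `multi`, `¬ Φ`, `normal form`
  are contradictory), over the r24 chain (McCallum Cor. 5.6 upper half, Jetchev MAX walk, inert ORDER display, E′-road SAVED display, TL₃); twin.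
So: 19109 ⟸ {19112, 27981, 19524, 19716, 23176, 23177, 23178} ∧ (Z);  (Z) ⟸ {19112, 23176, 23178} ∧ 23334  (line costepl);
(Z) ⟸ {19112, 23176, 23178} ∧ CartanRoadAtThree ∧ CoStepLResidualOffCartanAtThree  (line cartan). Nothing is booked.

References: [JetchevSkinnerWan2017] §7.4.2; [Castella2018] Thm. 3.2 (shape); [Skinner2016PacificMC] Thm. C; [McCallumLMS1991] Cor. 5.6;
[Jetchev2008] Thm. 1.4, Cor. 1.5; [GrossLMS1991] Prop. 3.7 (2), §6; [PastenShimura2024] §6; [KohenPacetti2016] Thm. 3.6–3.7, Rem. 3.8 (Cartan, shape);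
tree `Cruxes/EulerHalvesAtThree/Lines/inert.lean` (r24 registered: zero stubs, eight items).
-/

set_option linter.dupNamespace false
set_option autoImplicit false

noncomputable section

open scoped Classical NumberField Pointwise

namespace Summit.BirchSwinnertonDyer.BirchSwinnertonDyer.Theorems.EulerHalvesResidualUB

open WeierstrassCurve IsDedekindDomain NumberField Field Literature.NumberTheory.EllipticCurves
  Literature.NumberTheory.EllipticCurves.ModularForms Literature.NumberTheory.EllipticCurves.Jetchev2008
  Literature.NumberTheory.EllipticCurves.KolyvaginCocycle
  Literature.NumberTheory.EllipticCurves.Rank1Residual Literature.NumberTheory.GaloisRepresentations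
  Literature.NumberTheory.GaloisRepresentations.DiscreteGaloisModule
  Literature.NumberTheory.GaloisCohomology Literature.NumberTheory.Automorphic
  Literature.NumberTheory.EllipticCurves.BarriosEtAl2025 CongruenceSubgroup
  Summit.BirchSwinnertonDyer.Rank1Residual Summit.BirchSwinnertonDyer.Rank1Residual.X11b
  Summit.BirchSwinnertonDyer.Rank1Residual.X11b.Three Koly
  Summit.BirchSwinnertonDyer.Rank1Residual.JET
  Literature.NumberTheory.EllipticCurves.Rank1Residual.Typed Literature.NumberTheory.QuadraticFields.Quadratic
  Summit.BirchSwinnertonDyer.Rank1Residual.X11b.AcSelmer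
  Summit.BirchSwinnertonDyer.BirchSwinnertonDyer.Theorems


/-! ### §1. The co-chain conversion at one curve, (ram) or not -/

/-- **`CoStepLAt W` ∧ X11b ∧ surj ⟹ `Typed.MissingUpperBoundAt W 3`** (print inputs, both Poitou–Tate dualities, TL₃): case split on
(ram) — `Koly.missingUpperBoundAt_three_of_classX11b_of_ram_of_coStepLAt` ∕ `Koly.missingUpperBoundAt_three_of_classX11b_of_surj_of_coStepLAt_of_twistLower`
(corner3 g0's co-chain road at one curve). CONDITIONAL on every binder; nothing booked.
[cite: JetchevSkinnerWan2017, §7.4.2 (arXiv:1512.06894 p. 31)] [cite: Castella2018, Thm. 3.2 (p. 9) (shape)] [cite: Skinner2016PacificMC, Thm. C (§1)] -/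
theorem missingUpperBoundAt_three_of_classX11b_of_surj_of_coStepLAt
    (hGZ : ∀ (N : ℕ) [NeZero N] (W : WeierstrassCurve ℚ) (K : Type) [Field K] [NumberField K],
      gross_zagier N W K)
    (hKo : ∀ (N : ℕ) [NeZero N] (W : WeierstrassCurve ℚ) (K : Type) [Field K] [NumberField K],
      kolyvagin N W K)
    (hSk : Skinner2016.thmC_padicValRat_bsd_rank_zero)
    (hGZK : rank_eq_analyticRank_of_analyticRank_le_one) (hmod : hasEntireLFunction_rat)
    (hnf : exists_isNewformOf) (hHL : HoffsteinLuo1997_exists_twist_L_one_ne_zero)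
    (hMaz : mazur_not_dvd_maninConstant_of_odd)
    (hPT : ∀ (K : Type) [Field K] [NumberField K], poitouTate_selmerStructure_duality K)
    (hPT2 : ∀ (K : Type) [Field K] [NumberField K], poitouTate_sha_tateDual K)
    (hTL : ∀ (V : WeierstrassCurve ℚ) [V.IsElliptic] [V.IsGloballyMinimal],
      V.HasMultiplicativeReductionAtPrime 3 → V.HasIrreducibleModPGaloisRep 3 →
      V.entireLFunction 1 ≠ 0 → Finite V.sha →
      ∃ q : ℚ, V.entireLFunction 1 / (V.realPeriodRat : ℂ) = (q : ℂ) ∧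
        padicValRat 3 q ≤ (padicValNat 3 V.shaOrder : ℤ) + padicValNat 3 V.tamagawaProduct -
          2 * padicValNat 3 V.torsionOrder)
    (W : WeierstrassCurve ℚ) [W.IsElliptic] [W.IsGloballyMinimal]
    (hco : CoStepLAt W) (hX : ClassX11b W 3) (hρ : Surj W 3) :
    Typed.MissingUpperBoundAt W 3 := by
  by_cases hram : Ram W 3
  · exact Koly.missingUpperBoundAt_three_of_classX11b_of_ram_of_coStepLAt
      hGZ hKo hSk hGZK hmod hnf hHL hMaz hPT hPT2 W hco hX hram
  · exact Koly.missingUpperBoundAt_three_of_classX11b_of_surj_of_coStepLAt_of_twistLower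
      hGZ hKo hGZK hmod hnf hHL hMaz hPT hPT2 hTL W hco hX hρ

/-! ### §2. Line `costepl` on the output-form residue: ZERO stubs (items 19112, 23176, 23178, 23334 BY NAME) -/

/-- **(Z) from item 23334 and the items 19112 ∕ 23176 ∕ 23178 BY NAME** — the IMC-form residue gives the output-form residue through the
co-chain conversion (§1), TL₃ being read off the X11a lower half at 3 (`Koly.twistLowerAtThree_of_thmC_of_x11aLowerHalfAtThree`) and the
Selmer-structure duality off the kernel theorem `SchneiderFreeAdditiveX3.PoitouTateReduction.selmerComplement_canonical_holds`.
CONDITIONAL on the four items; nothing booked. [cite: JetchevSkinnerWan2017, §7.4.2 (p. 31)] [cite: Skinner2016PacificMC, Thm. C (§1)] -/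
theorem residualUpperBound_of_items_of_coStepLResidual
    (h : Summit.BirchSwinnertonDyer.BirchSwinnertonDyer.Theses.ClassRecordThree.PublishedInputsThree)
    (hPT2 : Summit.BirchSwinnertonDyer.BirchSwinnertonDyer.Theses.ClassRecordThree.PoitouTateShaTateDualFact)
    (hX : Summit.BirchSwinnertonDyer.BirchSwinnertonDyer.Theses.ClassRecordThree.X11aLowerHalfAtThree)
    (hRes : Summit.BirchSwinnertonDyer.BirchSwinnertonDyer.Theses.ClassRecordThree.EulerHalvesAtThreeCoStepLResidual) :
    ∀ (W : WeierstrassCurve ℚ) [W.IsElliptic] [W.IsGloballyMinimal],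
      ClassX11b W 3 → Surj W 3 → MultiCarrierAt W → ResidualNormalFormAt W → Typed.MissingUpperBoundAt W 3 := by
  have hPT : ∀ (K : Type) [Field K] [NumberField K], poitouTate_selmerStructure_duality_conj K :=
    poitouTate_conj_forall_of_selmerComplement_canonical fun K _ _ n _ ↦
      Summit.BirchSwinnertonDyer.BirchSwinnertonDyer.Theorems.SchneiderFreeAdditiveX3.PoitouTateReduction.selmerComplement_canonical_holds
        K n
  have hX3 : ∀ (V : WeierstrassCurve ℚ) [V.IsElliptic] [V.IsGloballyMinimal],
      Summit.BirchSwinnertonDyer.Rank1Residual.ClassX11a V 3 →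
        Literature.NumberTheory.EllipticCurves.Rank1Residual.Typed.MissingLowerBoundAt V 3 := hX
  obtain ⟨hGZ, hKo, -, hSk, -, hGZK, hmod, hnf, hHL, hMaz, -, -, -, -, -, -, -, -, -, -⟩ := h
  have hTL := Koly.twistLowerAtThree_of_thmC_of_x11aLowerHalfAtThree
    hmod hGZK hSk hX3
  intro W _ _ hXW hρ hm hr
  exact missingUpperBoundAt_three_of_classX11b_of_surj_of_coStepLAt hGZ hKo hSk hGZK hmod hnf hHL hMaz
    (fun K _ _ ↦ poitouTate_selmerStructure_duality_of_conj (hPT K)) hPT2 hTL W (hRes W hm hr) hXW hρ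

/-- The `KolyvaginRoadThree` twin of `residualUpperBound_of_items_of_coStepLResidual` (KR3's copies of 23176 ∕ 23178 ∕ 23334; 19112 is CR3's,
shared by id as in r10–r24). [cite: JetchevSkinnerWan2017, §7.4.2 (p. 31)] -/
theorem kolyvaginRoadThree_residualUpperBound_of_items_of_coStepLResidual
    (h : Summit.BirchSwinnertonDyer.BirchSwinnertonDyer.Theses.ClassRecordThree.PublishedInputsThree)
    (hPT2 : Summit.BirchSwinnertonDyer.BirchSwinnertonDyer.Theses.KolyvaginRoadThree.PoitouTateShaTateDualFact)
    (hX : Summit.BirchSwinnertonDyer.BirchSwinnertonDyer.Theses.KolyvaginRoadThree.X11aLowerHalfAtThree)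
    (hRes : Summit.BirchSwinnertonDyer.BirchSwinnertonDyer.Theses.KolyvaginRoadThree.EulerHalvesAtThreeCoStepLResidual) :
    ∀ (W : WeierstrassCurve ℚ) [W.IsElliptic] [W.IsGloballyMinimal],
      ClassX11b W 3 → Surj W 3 → MultiCarrierAt W → ResidualNormalFormAt W → Typed.MissingUpperBoundAt W 3 :=
  residualUpperBound_of_items_of_coStepLResidual h hPT2 hX hRes

/-! ### §3. Line `cartan` on the output-form residue: the Cartan road and the SMALLER IMC-form residue off it -/

/-- **(Z) from the Cartan road `Three.CartanRoadAtThree`, the IMC-form residue OFF the Cartan-servable curves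
`Three.CoStepLResidualOffCartanAtThree`, and the items 19112 ∕ 23176 ∕ 23178 BY NAME**: case split on `CartanServableAtThree W`; on the road
the bound is the road's output, off it the co-chain conversion (§1) of the residue's `CoStepLAt W`. The road itself is DERIVED from its four
inputs ((F4) frames with budget set, (F5′) additive twist law, the K1 saving display, X11a lower half at 3) and the print items by
`CartanKernel.cartanRoadAtThree_of_inputs` (p662140). CONDITIONAL on every binder; nothing booked.
[cite: KohenPacetti2016, Thm. 3.6, Thm. 3.7, Rem. 3.8 (shape)] [cite: JetchevSkinnerWan2017, §7.4.2 (p. 31)] -/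
theorem residualUpperBound_of_items_of_cartanRoad_of_coStepLOffCartan
    (h : Summit.BirchSwinnertonDyer.BirchSwinnertonDyer.Theses.ClassRecordThree.PublishedInputsThree)
    (hPT2 : Summit.BirchSwinnertonDyer.BirchSwinnertonDyer.Theses.ClassRecordThree.PoitouTateShaTateDualFact)
    (hX : Summit.BirchSwinnertonDyer.BirchSwinnertonDyer.Theses.ClassRecordThree.X11aLowerHalfAtThree)
    (hCart : CartanRoadAtThree)
    (hOff : CoStepLResidualOffCartanAtThree) :
    ∀ (W : WeierstrassCurve ℚ) [W.IsElliptic] [W.IsGloballyMinimal],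
      ClassX11b W 3 → Surj W 3 → MultiCarrierAt W → ResidualNormalFormAt W → Typed.MissingUpperBoundAt W 3 := by
  have hPT : ∀ (K : Type) [Field K] [NumberField K], poitouTate_selmerStructure_duality_conj K :=
    poitouTate_conj_forall_of_selmerComplement_canonical fun K _ _ n _ ↦
      Summit.BirchSwinnertonDyer.BirchSwinnertonDyer.Theorems.SchneiderFreeAdditiveX3.PoitouTateReduction.selmerComplement_canonical_holds
        K n
  have hX3 : ∀ (V : WeierstrassCurve ℚ) [V.IsElliptic] [V.IsGloballyMinimal],
      Summit.BirchSwinnertonDyer.Rank1Residual.ClassX11a V 3 →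
        Literature.NumberTheory.EllipticCurves.Rank1Residual.Typed.MissingLowerBoundAt V 3 := hX
  obtain ⟨hGZ, hKo, -, hSk, -, hGZK, hmod, hnf, hHL, hMaz, -, -, -, -, -, -, -, -, -, -⟩ := h
  have hTL := Koly.twistLowerAtThree_of_thmC_of_x11aLowerHalfAtThree
    hmod hGZK hSk hX3
  intro W _ _ hXW hρ hm hr
  by_cases hc : CartanServableAtThree W
  · exact hCart W hXW hρ hc
  · exact missingUpperBoundAt_three_of_classX11b_of_surj_of_coStepLAt hGZ hKo hSk hGZK hmod hnf hHL hMaz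
      (fun K _ _ ↦ poitouTate_selmerStructure_duality_of_conj (hPT K)) hPT2 hTL W (hOff W hm hc hr) hXW hρ

/-- The `KolyvaginRoadThree` twin of `residualUpperBound_of_items_of_cartanRoad_of_coStepLOffCartan`.
[cite: KohenPacetti2016, Thm. 3.6, Thm. 3.7, Rem. 3.8 (shape)] -/
theorem kolyvaginRoadThree_residualUpperBound_of_items_of_cartanRoad_of_coStepLOffCartan
    (h : Summit.BirchSwinnertonDyer.BirchSwinnertonDyer.Theses.ClassRecordThree.PublishedInputsThree)
    (hPT2 : Summit.BirchSwinnertonDyer.BirchSwinnertonDyer.Theses.KolyvaginRoadThree.PoitouTateShaTateDualFact)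
    (hX : Summit.BirchSwinnertonDyer.BirchSwinnertonDyer.Theses.KolyvaginRoadThree.X11aLowerHalfAtThree)
    (hCart : CartanRoadAtThree)
    (hOff : CoStepLResidualOffCartanAtThree) :
    ∀ (W : WeierstrassCurve ℚ) [W.IsElliptic] [W.IsGloballyMinimal],
      ClassX11b W 3 → Surj W 3 → MultiCarrierAt W → ResidualNormalFormAt W → Typed.MissingUpperBoundAt W 3 :=
  residualUpperBound_of_items_of_cartanRoad_of_coStepLOffCartan h hPT2 hX hCart hOff

/-! ### §4. r25 of line `inert`: crux 19109 BY NAME from its seven other route items and the output-form residue (Z) -/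

/-- **r25: crux 19109 `EulerHalvesAtThree` BY NAME from its seven other route items BY NAME and the output-form residue (Z)** — the
road-agnostic composition `EulerHalvesExtraRoad.classRecordThree_eulerHalvesAtThree_of_inertRoads_of_extraRoad_of_coStepLResidualOffRoad` (p658732) at
`Φ := fun W ↦ MultiCarrierAt W ∧ ResidualNormalFormAt W` with `hRoad := (Z)` and `hcoRes` VACUOUS, over the r24 chain: McCallum Cor. 5.6 upper
half (`…_of_casselsTate_of_frobeniusCongruence_of_E0`), Jetchev's MAX walk at `3 ∥ N` (`jetchevMaxHLAtThree_of_swapLiterature`), the inert ORDER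
display (`inertDisplayAtThree_of_primitivesAtThreeInert_of_casselsTateLevelInputs`), the E′-road SAVED display
(`ShimuraWalk.inertSavingDisplayAtThreeD_of_primitives_of_E0Prime_of_milne_of_poitouTate_of_casselsTate` over `EulerHalvesInertR21.e0PrimeSupplyAtThree`),
TL₃ (`Koly.twistLowerAtThree_of_thmC_of_x11aLowerHalfAtThree`); kernel theorems for the Cassels–Tate level inputs (bsd-wall), the Selmer-structure
duality (bsd-schneider) and Milne I.3.8 (corner3-p2). CONDITIONAL on the seven items and (Z); nothing booked.
[cite: McCallumLMS1991, §5 Cor. 5.6 (p. 310)] [cite: Jetchev2008, Thm. 1.4 (p. 812)] [cite: GrossLMS1991, Prop. 3.7 (2), §6]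
[cite: PastenShimura2024, Prop. 5.1, §6.6] [cite: Skinner2016PacificMC, Thm. C (§1)] [cite: Harari2020, Thm. 17.13 (b)] -/
theorem eulerHalvesAtThree_of_items_of_residualUpperBound
    (h : Summit.BirchSwinnertonDyer.BirchSwinnertonDyer.Theses.ClassRecordThree.PublishedInputsThree)
    (hF : Summit.BirchSwinnertonDyer.BirchSwinnertonDyer.Theses.ClassRecordThree.EulerHalfGrossPrintFacts)
    (hSh : Summit.BirchSwinnertonDyer.BirchSwinnertonDyer.Theses.ClassRecordThree.ShimuraParametrizationDataNonempty)
    (hCO : Summit.BirchSwinnertonDyer.BirchSwinnertonDyer.Theses.ClassRecordThree.PastenComponentOrdersInput)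
    (hPT2 : Summit.BirchSwinnertonDyer.BirchSwinnertonDyer.Theses.ClassRecordThree.PoitouTateShaTateDualFact)
    (hPrim : Summit.BirchSwinnertonDyer.BirchSwinnertonDyer.Theses.ClassRecordThree.ShimuraPrimitivesAtThreeInertFact)
    (hX : Summit.BirchSwinnertonDyer.BirchSwinnertonDyer.Theses.ClassRecordThree.X11aLowerHalfAtThree)
    -- the OUTPUT-form residue (Z), unfolded (= `Theorems.EulerHalvesAtThreeResidualUpperBound` by `δ`):
    (hZ : ∀ (W : WeierstrassCurve ℚ) [W.IsElliptic] [W.IsGloballyMinimal],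
      ClassX11b W 3 → Surj W 3 → MultiCarrierAt W → ResidualNormalFormAt W → Typed.MissingUpperBoundAt W 3) :
    Summit.BirchSwinnertonDyer.BirchSwinnertonDyer.Theses.ClassRecordThree.EulerHalvesAtThree := by
  have hF1 : Gross1991_heegnerPoint_sub_ratTorsion_mem_E0 := Gross1991_heegnerPoint_sub_ratTorsion_mem_E0_of_imageFree hF.2
  -- the Cassels–Tate level inputs: cell bsd-wall's Ш²-cochain bridge (the proof term of item 20191's closer
  -- `ShaTwoCochainTheta.casselsTate_levelInputs_of_shaTwoCochainBridge`, restated over its three route-independent modules)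
  have hCT : ∀ (K : Type) [Field K] [NumberField K], casselsTate_levelInputs K := fun K _ _ ↦
    ShaTwoCochainTheta.casselsTate_levelInputs_of_readout_vanishing_flip K
      (ShaTwoCochainTheta.hbridge_of_readout_criterion K
        (ShaTwoCochain.classBarInv_readout_eq_zero_of_criterion K))
  have hPT : ∀ (K : Type) [Field K] [NumberField K], poitouTate_selmerStructure_duality_conj K :=
    poitouTate_conj_forall_of_selmerComplement_canonical fun K _ _ n _ ↦
      Summit.BirchSwinnertonDyer.BirchSwinnertonDyer.Theorems.SchneiderFreeAdditiveX3.PoitouTateReduction.selmerComplement_canonical_holds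
        K n
  have hM38 : Milne2006_localTamagawaNumber_smul_unramifiedClass_eq_zero.{0} :=
    MilneTamagawa.Milne2006_localTamagawaNumber_smul_unramifiedClass_eq_zero_holds
  have hX3 : ∀ (V : WeierstrassCurve ℚ) [V.IsElliptic] [V.IsGloballyMinimal],
      Summit.BirchSwinnertonDyer.Rank1Residual.ClassX11a V 3 →
        Literature.NumberTheory.EllipticCurves.Rank1Residual.Typed.MissingLowerBoundAt V 3 := hX
  obtain ⟨hGZ, hKo, -, hSk, -, hGZK, hmod, hnf, hHL, hMaz, -, hFH, hBR, -, -, -, -, -, -, -⟩ := h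
  have hMcU : McCallum1991_padicValNat_card_sha_primary_add_le_of_globalDivisibility :=
    McCallum1991_padicValNat_card_sha_primary_add_le_of_globalDivisibility_of_casselsTate_of_frobeniusCongruence_of_E0 hCT hF.1 hF1
  have hJ := jetchevMaxHLAtThree_of_swapLiterature hF.1 hGZ hmod hPT hF1
  have hDisp := inertDisplayAtThree_of_primitivesAtThreeInert_of_casselsTateLevelInputs hCT hPrim
  have hSav := ShimuraWalk.inertSavingDisplayAtThreeD_of_primitives_of_E0Prime_of_milne_of_poitouTate_of_casselsTate
    (fun V ↦ Surj V 3) (fun _ _ _ _ hsurj ↦ hsurj) hCT hPrim hM38 hPT EulerHalvesInertR21.e0PrimeSupplyAtThree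
  have hTL := Koly.twistLowerAtThree_of_thmC_of_x11aLowerHalfAtThree
    hmod hGZK hSk hX3
  exact EulerHalvesExtraRoad.classRecordThree_eulerHalvesAtThree_of_inertRoads_of_extraRoad_of_coStepLResidualOffRoad
    hGZ hKo hSk hGZK hmod hnf hHL hMaz (fun N _ W K _ _ ↦ heegnerPointOfConductor_one_galoisConj_holds N W K)
    (fun N _ W K _ _ ↦ phi_heegnerTau_mem_singularModuliField_holds N W K) hMcU
    (fun K _ _ ↦ poitouTate_selmerStructure_duality_of_conj (hPT K)) hPT2 hFH hBR
    hSh hCO hJ hDisp hTL hSav hX3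
    -- the extra road := the residual class itself, served by (Z); the off-road residue is then VACUOUS
    (fun W _ _ ↦ MultiCarrierAt W ∧ ResidualNormalFormAt W)
    (fun W _ _ hXW hρ hΦ ↦ hZ W hXW hρ hΦ.1 hΦ.2)
    (fun W _ _ hm hnΦ hr ↦ (hnΦ ⟨hm, hr⟩).elim)

/-- The `KolyvaginRoadThree` twin of `eulerHalvesAtThree_of_items_of_residualUpperBound` (KR3's copies of 27981 ∕ 19524 ∕ 19716 ∕ 23176 ∕ 23177 ∕
23178; 19112 is CR3's, shared by id). [cite: McCallumLMS1991, §5 Cor. 5.6 (p. 310)] [cite: Jetchev2008, Thm. 1.4 (p. 812)] -/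
theorem kolyvaginRoadThree_eulerHalvesAtThree_of_items_of_residualUpperBound
    (h : Summit.BirchSwinnertonDyer.BirchSwinnertonDyer.Theses.ClassRecordThree.PublishedInputsThree)
    (hF : Summit.BirchSwinnertonDyer.BirchSwinnertonDyer.Theses.KolyvaginRoadThree.EulerHalfGrossPrintFacts)
    (hSh : Summit.BirchSwinnertonDyer.BirchSwinnertonDyer.Theses.KolyvaginRoadThree.ShimuraParametrizationDataNonempty)
    (hCO : Summit.BirchSwinnertonDyer.BirchSwinnertonDyer.Theses.KolyvaginRoadThree.PastenComponentOrdersInput)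
    (hPT2 : Summit.BirchSwinnertonDyer.BirchSwinnertonDyer.Theses.KolyvaginRoadThree.PoitouTateShaTateDualFact)
    (hPrim : Summit.BirchSwinnertonDyer.BirchSwinnertonDyer.Theses.KolyvaginRoadThree.ShimuraPrimitivesAtThreeInertFact)
    (hX : Summit.BirchSwinnertonDyer.BirchSwinnertonDyer.Theses.KolyvaginRoadThree.X11aLowerHalfAtThree)
    (hZ : ∀ (W : WeierstrassCurve ℚ) [W.IsElliptic] [W.IsGloballyMinimal],
      ClassX11b W 3 → Surj W 3 → MultiCarrierAt W → ResidualNormalFormAt W → Typed.MissingUpperBoundAt W 3) :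
    Summit.BirchSwinnertonDyer.BirchSwinnertonDyer.Theses.KolyvaginRoadThree.EulerHalvesAtThree :=
  eulerHalvesAtThree_of_items_of_residualUpperBound h hF hSh hCO hPT2 hPrim hX hZ

end Summit.BirchSwinnertonDyer.BirchSwinnertonDyer.Theorems.EulerHalvesResidualUB

end
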